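import Mathlib
import Summits.Ventures.PercRepro2.TB13AvoidEdge

/-!
# The edge between the two marks never hurts (typed BHK 1.3): Theorem S
(blind cell PercRepro2, mine-c g18, 2026-08-25; `proofs/MINEC-TB14BLOCK.md` §12.11)

For the typed BHK 1.3 kernel `foldK13 ends a₁ a₂ x o` (root `a₂`, avoided root `a₁`, marks `x`, `o`)
and a free edge `e = x o`, the defect of the split on `e` (`pairCount_split_edge`) is, at every pair
with `e` closed, `N + X` with `N ≥ 0` pointwise (four pieces: both marks red-only; `x` red-only and
`o` blue-only with `x` blue-connected to `a₁`; `x` red-only and `o` in neither cluster with `o` not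
red-connected to `a₁`; `x` not red and `o` red-only with `x` not red-connected to `a₁`) and `X`
antisymmetric under the exchange of the copies (`x` in both clusters, `o` in neither).  Hence
(`pairCount_foldK13_le_markEdge`) `S₁₃(G − xo) ≤ S₁₃(G)` at every profile in which `xo` is free.
Exact check `data/mine-c/g18/scripts/tb13mono.c` (the closed formula, every avoid set, n ≤ 7 m ≤ 9,
0 failures).  Own work; standard axioms.
-/

namespace Summit.Ventures.PercRepro2

namespace TB14Cut

open CovForm A3InactiveTyped

section MarkEdge13

variable {V : Type} {E : Type} [Fintype E] [DecidableEq E] {R : Type*} [Field R]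
variable {ends : E → Sym2 V} {e : E} {a₁ a₂ x o : V}

/-- The nonnegative part of the defect of the edge `x o` (typed BHK 1.3). -/
noncomputable def markEdge13N (ends : E → Sym2 V) (a₁ a₂ x o : V) : Config E → Config E → R :=
  fun y w => iQ ends a₁ a₂ y * iQ ends a₁ a₂ w *
    (iH ends a₂ x y * iH ends a₂ o y * (1 - iH ends a₂ x w) * (1 - iH ends a₂ o w) +
      iH ends a₂ x y * (1 - iH ends a₂ x w) * iH ends a₂ o w * (1 - iH ends a₂ o y) *
        iL ends a₁ x w +
      iH ends a₂ x y * (1 - iH ends a₂ x w) * (1 - iH ends a₂ o y) * (1 - iH ends a₂ o w) *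
        (1 - iL ends a₁ o y) +
      (1 - iH ends a₂ x y) * iH ends a₂ o y * (1 - iH ends a₂ o w) * (1 - iL ends a₁ x y))

/-- The antisymmetric part of the defect of the edge `x o` (typed BHK 1.3). -/
noncomputable def markEdge13X (ends : E → Sym2 V) (a₁ a₂ x o : V) : Config E → Config E → R :=
  fun y w => iQ ends a₁ a₂ y * iQ ends a₁ a₂ w * iH ends a₂ x y * iH ends a₂ x w *
    (1 - iH ends a₂ o y) * (1 - iH ends a₂ o w) * ((1 - iL ends a₁ o y) - (1 - iL ends a₁ o w))

omit [Fintype E] [DecidableEq E] in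
/-- The antisymmetric part changes sign under the exchange of the two copies. -/
lemma markEdge13X_swap (y w : Config E) :
    (markEdge13X ends a₁ a₂ x o w y : R) = - markEdge13X ends a₁ a₂ x o y w := by
  simp only [markEdge13X]; ring

omit [Fintype E] [DecidableEq E] in
/-- The nonnegative part is pointwise nonnegative (a sum of products of indicators). -/
lemma markEdge13N_nonneg [LinearOrder R] [IsStrictOrderedRing R] (y w : Config E) :
    (0 : R) ≤ markEdge13N ends a₁ a₂ x o y w := by
  classical
  simp only [markEdge13N, iQ_eq_ite', iL_eq_ite', iH_eq_ite']
  split_ifs <;> norm_num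

omit [Fintype E] in
/-- The Boolean core of Theorem S.  `A1 = a₁ ↔_y a₂`, `A2 = a₁ ↔_w a₂`, `A5 = a₂ ↔_y x`,
`A6 = a₂ ↔_y o`, `A7 = a₂ ↔_w x`, `A8 = a₂ ↔_w o`, `R1 = a₁ ↔_y x`, `R2 = a₁ ↔_y o`, `S1 = a₁ ↔_w x`,
`S2 = a₁ ↔_w o`; the four transitivity implications are the hypotheses. -/
lemma markEdge13_key (A1 A2 A5 A6 A7 A8 R1 R2 S1 S2 : Prop) [Decidable A1] [Decidable A2]
    [Decidable A5] [Decidable A6] [Decidable A7] [Decidable A8] [Decidable R1] [Decidable R2]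
    [Decidable S1] [Decidable S2] (h15 : R1 → A5 → A1) (h26 : R2 → A6 → A1) (h17 : S1 → A7 → A2)
    (h28 : S2 → A8 → A2) :
    (if A1 ∨ (R1 ∧ A6) ∨ (R2 ∧ A5) then (0 : R) else 1) * (if A2 then 0 else 1) *
          (if A5 ∨ A6 then 1 else 0) * ((if A6 ∨ A5 then 1 else 0) - (if A8 then 1 else 0)) +
        (if A1 then 0 else 1) * (if A2 ∨ (S1 ∧ A8) ∨ (S2 ∧ A7) then 0 else 1) *
          (if A5 then 1 else 0) * ((if A6 then 1 else 0) - (if A8 ∨ A7 then 1 else 0)) -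
        (if A1 then 0 else 1) * (if A2 then 0 else 1) * (if A5 then 1 else 0) *
          ((if A6 then 1 else 0) - (if A8 then 1 else 0)) =
      (if A1 then 0 else 1) * (if A2 then 0 else 1) *
          ((if A5 then 1 else 0) * (if A6 then 1 else 0) * (1 - (if A7 then 1 else 0)) *
              (1 - (if A8 then 1 else 0)) +
            (if A5 then 1 else 0) * (1 - (if A7 then 1 else 0)) * (if A8 then 1 else 0) *
              (1 - (if A6 then 1 else 0)) * (if S1 then 1 else 0) +
            (if A5 then 1 else 0) * (1 - (if A7 then 1 else 0)) * (1 - (if A6 then 1 else 0)) *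
              (1 - (if A8 then 1 else 0)) * (1 - (if R2 then 1 else 0)) +
            (1 - (if A5 then 1 else 0)) * (if A6 then 1 else 0) * (1 - (if A8 then 1 else 0)) *
              (1 - (if R1 then 1 else 0))) +
        (if A1 then 0 else 1) * (if A2 then 0 else 1) * (if A5 then 1 else 0) *
          (if A7 then 1 else 0) * (1 - (if A6 then 1 else 0)) * (1 - (if A8 then 1 else 0)) *
          ((1 - (if R2 then 1 else 0)) - (1 - (if S2 then 1 else 0))) := by
  by_cases hA1 : A1
  · simp [hA1]
  by_cases hA2 : A2
  · simp [hA2]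
  have hR1 : R1 → ¬ A5 := fun h h' => hA1 (h15 h h')
  have hR2 : R2 → ¬ A6 := fun h h' => hA1 (h26 h h')
  have hS1 : S1 → ¬ A7 := fun h h' => hA2 (h17 h h')
  have hS2 : S2 → ¬ A8 := fun h h' => hA2 (h28 h h')
  by_cases hA5 : A5 <;> by_cases hA6 : A6 <;> by_cases hA7 : A7 <;> by_cases hA8 : A8 <;>
    simp_all <;> (try split_ifs) <;> ring

omit [Fintype E] in
/-- The defect of the edge `x o` at a pair with the edge closed in both copies is `N + X`. -/
lemma edgeDefect_foldK13_xo (he : ends e = s(x, o)) (y₂ w₂ : Config E) (hy : y₂ e = false)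
    (hw : w₂ e = false) :
    (edgeDefect (foldK13 ends a₁ a₂ x o : Config E → Config E → R) e y₂ w₂) =
      markEdge13N ends a₁ a₂ x o y₂ w₂ + markEdge13X ends a₁ a₂ x o y₂ w₂ := by
  classical
  have hy' := conn_update_true_iff (ends := ends) he hy
  have hw' := conn_update_true_iff (ends := ends) he hw
  have hQy' : Conn ends (Function.update y₂ e true) a₁ a₂ ↔
      Conn ends y₂ a₁ a₂ ∨ (Conn ends y₂ a₁ x ∧ Conn ends y₂ a₂ o) ∨
        (Conn ends y₂ a₁ o ∧ Conn ends y₂ a₂ x) := by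
    rw [hy' a₁ a₂]
    constructor
    · rintro (h | ⟨h1, h2⟩ | ⟨h1, h2⟩)
      · exact Or.inl h
      · exact Or.inr (Or.inl ⟨h1, conn_symm h2⟩)
      · exact Or.inr (Or.inr ⟨h1, conn_symm h2⟩)
    · rintro (h | ⟨h1, h2⟩ | ⟨h1, h2⟩)
      · exact Or.inl h
      · exact Or.inr (Or.inl ⟨h1, conn_symm h2⟩)
      · exact Or.inr (Or.inr ⟨h1, conn_symm h2⟩)
  have hXy' : Conn ends (Function.update y₂ e true) a₂ x ↔
      Conn ends y₂ a₂ x ∨ Conn ends y₂ a₂ o := by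
    rw [hy' a₂ x]
    constructor
    · rintro (h | ⟨h1, _⟩ | ⟨h1, _⟩)
      · exact Or.inl h
      · exact Or.inl h1
      · exact Or.inr h1
    · rintro (h | h)
      · exact Or.inl h
      · exact Or.inr (Or.inr ⟨h, conn_refl _ _ _⟩)
  have hOy' : Conn ends (Function.update y₂ e true) a₂ o ↔
      Conn ends y₂ a₂ o ∨ Conn ends y₂ a₂ x := by
    rw [hy' a₂ o]
    constructor
    · rintro (h | ⟨h1, _⟩ | ⟨h1, _⟩)
      · exact Or.inl h
      · exact Or.inr h1
      · exact Or.inl h1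
    · rintro (h | h)
      · exact Or.inl h
      · exact Or.inr (Or.inl ⟨h, conn_refl _ _ _⟩)
  have hQw' : Conn ends (Function.update w₂ e true) a₁ a₂ ↔
      Conn ends w₂ a₁ a₂ ∨ (Conn ends w₂ a₁ x ∧ Conn ends w₂ a₂ o) ∨
        (Conn ends w₂ a₁ o ∧ Conn ends w₂ a₂ x) := by
    rw [hw' a₁ a₂]
    constructor
    · rintro (h | ⟨h1, h2⟩ | ⟨h1, h2⟩)
      · exact Or.inl h
      · exact Or.inr (Or.inl ⟨h1, conn_symm h2⟩)
      · exact Or.inr (Or.inr ⟨h1, conn_symm h2⟩)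
    · rintro (h | ⟨h1, h2⟩ | ⟨h1, h2⟩)
      · exact Or.inl h
      · exact Or.inr (Or.inl ⟨h1, conn_symm h2⟩)
      · exact Or.inr (Or.inr ⟨h1, conn_symm h2⟩)
  have hOw' : Conn ends (Function.update w₂ e true) a₂ o ↔
      Conn ends w₂ a₂ o ∨ Conn ends w₂ a₂ x := by
    rw [hw' a₂ o]
    constructor
    · rintro (h | ⟨h1, _⟩ | ⟨h1, _⟩)
      · exact Or.inl h
      · exact Or.inr h1
      · exact Or.inl h1
    · rintro (h | h)
      · exact Or.inl h
      · exact Or.inr (Or.inl ⟨h, conn_refl _ _ _⟩)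
  simp only [edgeDefect, foldK13, markEdge13N, markEdge13X, iQ_eq_ite', iL_eq_ite', iH_eq_ite',
    hQy', hXy', hOy', hQw', hOw']
  exact markEdge13_key (Conn ends y₂ a₁ a₂) (Conn ends w₂ a₁ a₂) (Conn ends y₂ a₂ x)
    (Conn ends y₂ a₂ o) (Conn ends w₂ a₂ x) (Conn ends w₂ a₂ o) (Conn ends y₂ a₁ x)
    (Conn ends y₂ a₁ o) (Conn ends w₂ a₁ x) (Conn ends w₂ a₁ o)
    (fun h h' => conn_trans h (conn_symm h')) (fun h h' => conn_trans h (conn_symm h'))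
    (fun h h' => conn_trans h (conn_symm h')) (fun h h' => conn_trans h (conn_symm h'))

/-- **THEOREM S — the edge between the two marks of typed BHK 1.3 never hurts**:
`S₁₃(G − x o) ≤ S₁₃(G)` at every profile in which `x o` is free. -/
theorem pairCount_foldK13_le_markEdge [LinearOrder R] [IsStrictOrderedRing R]
    (he : ends e = s(x, o)) (F : Finset E) (z : Config E) (heF : e ∈ F) :
    pairCount (F.erase e) (Function.update z e false)
        (foldK13 ends a₁ a₂ x o : Config E → Config E → R) ≤
      pairCount F z (foldK13 ends a₁ a₂ x o) := by
  classical
  rw [pairCount_split_edge _ F z heF]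
  refine le_add_of_nonneg_right ?_
  have hsplit : pairCount (F.erase e) (Function.update z e false)
      (edgeDefect (foldK13 ends a₁ a₂ x o : Config E → Config E → R) e) =
      pairCount (F.erase e) (Function.update z e false) (markEdge13N ends a₁ a₂ x o) +
        pairCount (F.erase e) (Function.update z e false) (markEdge13X ends a₁ a₂ x o) := by
    unfold pairCount
    rw [← Finset.sum_add_distrib]
    refine Finset.sum_congr rfl fun y₂ _ => ?_
    by_cases hadm : ∀ f, f ∉ F.erase e → y₂ f = Function.update z e false f
    · rw [if_pos hadm, if_pos hadm, if_pos hadm]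
      have hy₂ : y₂ e = false := by
        have := hadm e (Finset.notMem_erase e F)
        rwa [Function.update_self] at this
      have hw₂ : A3InactiveTyped.flipOn (F.erase e) y₂ e = false := by
        rw [A3InactiveTyped.flipOn_of_notMem (Finset.notMem_erase e F)]; exact hy₂
      exact edgeDefect_foldK13_xo he y₂ _ hy₂ hw₂
    · rw [if_neg hadm, if_neg hadm, if_neg hadm, add_zero]
  rw [hsplit, pairCount_antisymm_eq_zero _ _ _ (markEdge13X_swap (ends := ends) (a₁ := a₁)
    (a₂ := a₂) (x := x) (o := o)), add_zero]
  exact pairCount_nonneg _ _ _ (fun y w => markEdge13N_nonneg y w)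

end MarkEdge13

end TB14Cut

end Summit.Ventures.PercRepro2
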